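import Literature.AnabelianGeometry.AbsoluteAnabelian.GaloisPadicLogPowers
import HarnessLib

/-!
# `log_k̄` on the `p`-adic units `ℤ_p^× ⊆ 𝒪_k^× ⊆ 𝒪_k̄^×`: `ℤ_p`-multiples of `log_k̄(1+p)` are logarithms of
# `p`-adic units (proof-only sequel of `GaloisPadicLogPowers.lean`)

S. Mochizuki, *Topics in absolute anabelian geometry III*, §3, Def. 3.1 (i)/(iv) p. 66/69 [MochizukiAbsTopIII2015]
(`log_k̄`, the pre-log-shell `log_k̄(𝒪_k^×)`), and *Inter-universal Teichmüller theory II*, §1, Remark 1.8.1 p. 42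
[claim: Mochizuki2012, status: disputed] (IUTchII §1 Rmk 1.8.1, kurims p.42): "the `p`-adic logarithm of the
cyclotomic character determines … a natural surjection `O^{×μ}(G) ↠ ℚ_p`" — the `ℚ_p`-line inside `k~ ≅ k̄` spanned
by the logarithms of the `p`-adic units.  abc-iut cell, seat abc-iut-L6-d2 (gen 5), row «B9-E-RMK181-GENUINE-COND».

For every `MLFClosure` `C = (k, k̄)` with residue characteristic `p` and the canonical embedding
`ι : ℚ_p → k → k̄` (`MLFClosure.padicScalar` on `ℤ_p`; `LocalField.padicRingHom`):

* `MLFClosure.algebraMap_padicRingHom_mem_unitSubmonoid` — `ι(ℤ_p^×) ⊆ 𝒪_k̄^×`;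
* `MLFClosure.exists_padicUnit_log_eq_mul` — **for `s ∈ ℤ_p^×` and `a ∈ ℤ_p` there is `s' ∈ ℤ_p^×` with
  `log_k̄ ι(s') = a · log_k̄ ι(s)`** (the `ℤ_p`-module `log_p(ℤ_p^×)`, abc-iut-S1's `smul_mem_logUnits` on `ℚ_p ⊆ ℚ̄_p`,
  transported BY RFL through the definition of `MLFClosure.galoisPadicLogOfResidueChar`);
* `MLFClosure.log_one_add_residueChar_ne_zero` — `log_k̄ ι(1 + p) ≠ 0` (`1 + p` is not a root of unity).

HONEST FRAMING: classical `p`-adic analysis; nothing here bears on [IUTchIII] Cor. 3.12.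
-/

set_option autoImplicit false

noncomputable section

namespace Literature.AnabelianGeometry.AbsoluteAnabelian

open ValuativeRel
open scoped ValuativeRel
open Literature.NumberTheory.Transcendental Literature.NumberTheory.GaloisRepresentations
open Literature.IUT.LogVolume

namespace MLFClosure

variable (C : MLFClosure.{0})

section ResidueChar

variable (p : ℕ) [hp : Fact p.Prime]

/-- `ι(s) ∈ 𝒪_k̄^×` for a `p`-adic unit `s ∈ ℤ_p^×`: its image in `k` has valuation `1`.
[cite: MochizukiAbsTopIII2015, Definition 3.1 (i) p.66] -/
theorem valuation_padicRingHom_units_eq_one (hpk : valuation C.k p < 1) (s : ℤ_[p]ˣ) :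
    valuation C.k (LocalField.padicRingHom C.k p hpk (s : ℤ_[p])) = 1 := by
  apply le_antisymm (LocalField.valuation_padicRingHom_le_one C.k p hpk (s : ℤ_[p]))
  have h1 : valuation C.k (LocalField.padicRingHom C.k p hpk (s : ℤ_[p])) *
      valuation C.k (LocalField.padicRingHom C.k p hpk ((s⁻¹ : ℤ_[p]ˣ) : ℤ_[p])) = 1 := by
    rw [← map_mul, ← map_mul, ← PadicInt.coe_mul, Units.mul_inv, PadicInt.coe_one, map_one, map_one]
  have h2 := LocalField.valuation_padicRingHom_le_one C.k p hpk ((s⁻¹ : ℤ_[p]ˣ) : ℤ_[p])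
  by_contra h
  rw [not_le] at h
  have := mul_lt_one_of_lt_of_le h h2
  rw [h1] at this
  exact lt_irrefl _ this

/-- `ι(ℤ_p^×) ⊆ 𝒪_k̄^×` (through `k`). [cite: MochizukiAbsTopIII2015, Definition 3.1 (i) p.66] -/
theorem algebraMap_padicRingHom_mem_unitSubmonoid_ofResidueChar (hpk : valuation C.k p < 1) (s : ℤ_[p]ˣ) :
    algebraMap C.k C.K (LocalField.padicRingHom C.k p hpk (s : ℤ_[p])) ∈ unitSubmonoid C.k C.K :=
  (algebraMap_mem_invariantUnits C.k C.K (C.valuation_padicRingHom_units_eq_one p hpk s)).1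

/-- **`ℤ_p`-multiples of logarithms of `p`-adic units are logarithms of `p`-adic units**, at a residue
characteristic `p`: for `s ∈ ℤ_p^×` and `a ∈ ℤ_p` there is `s' ∈ ℤ_p^×` with `log_k̄ ι(s') = a · log_k̄ ι(s)` (transport of
the `ℚ̄_p` statement `PadicAlgCl.exists_mem_adjoin_norm_eq_one_log_eq_mul` at `x = s ∈ ℚ_p`, where `ℚ_p(x) = ℚ_p`).
[cite: MochizukiAbsTopIII2015, Definition 3.1 (iv) p.69] -/
theorem exists_padicUnit_log_eq_mul_ofResidueChar (hpk : valuation C.k p < 1) (s : ℤ_[p]ˣ) (a : ℤ_[p]) :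
    ∃ s' : ℤ_[p]ˣ,
      (C.galoisPadicLogOfResidueChar p hpk).log (algebraMap C.k C.K (LocalField.padicRingHom C.k p hpk (s' : ℤ_[p]))) =
        algebraMap C.k C.K (LocalField.padicRingHom C.k p hpk (a : ℚ_[p])) *
          (C.galoisPadicLogOfResidueChar p hpk).log (algebraMap C.k C.K (LocalField.padicRingHom C.k p hpk (s : ℤ_[p]))) := by
  letI iQk : Algebra ℚ_[p] C.k := LocalField.padicAlgebra C.k p hpk
  letI iQK : Algebra ℚ_[p] C.K := ((algebraMap C.k C.K).comp (LocalField.padicRingHom C.k p hpk)).toAlgebra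
  haveI : IsScalarTower ℚ_[p] C.k C.K := IsScalarTower.of_algebraMap_eq fun _ => rfl
  haveI : FiniteDimensional ℚ_[p] C.k :=
    Literature.NumberTheory.PAdicHodge.PadicBase.instFiniteDimensional (F := C.k) (p := p) hpk
  haveI : IsAlgClosure ℚ_[p] C.K :=
    { isAlgClosed := IsAlgClosure.isAlgClosed C.k
      isAlgebraic := C.isAlgebraic_padic_K p hpk }
  let e : C.K ≃ₐ[ℚ_[p]] PadicAlgCl p := IsAlgClosure.equiv ℚ_[p] C.K (PadicAlgCl p)
  letI ikA : Algebra C.k (PadicAlgCl p) := (e.toAlgHom.toRingHom.comp (algebraMap C.k C.K)).toAlgebra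
  haveI hST : IsScalarTower ℚ_[p] C.k (PadicAlgCl p) := IsScalarTower.of_algebraMap_eq fun c => by
    change algebraMap ℚ_[p] (PadicAlgCl p) c = e (algebraMap C.k C.K (algebraMap ℚ_[p] C.k c))
    rw [← IsScalarTower.algebraMap_apply ℚ_[p] C.k C.K, AlgEquiv.commutes]
  let e' : C.K ≃ₐ[C.k] PadicAlgCl p :=
    { e.toRingEquiv with commutes' := fun _ => rfl }
  have hlog : ∀ z : C.K, (C.galoisPadicLogOfResidueChar p hpk).log z = e'.symm (padicLogAlgCl p (e' z)) :=
    fun _ => rfl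
  -- the scalars `ℚ_p → k → k̄` and `ℚ_p → ℚ̄_p` correspond under `e'`
  have hsc : ∀ c : ℚ_[p], e' (algebraMap C.k C.K (LocalField.padicRingHom C.k p hpk c)) = algebraMap ℚ_[p] (PadicAlgCl p) c := by
    intro c
    rw [IsScalarTower.algebraMap_apply ℚ_[p] C.k (PadicAlgCl p), AlgEquiv.commutes]
    rfl
  have hsc' : ∀ c : ℚ_[p], e'.symm (algebraMap ℚ_[p] (PadicAlgCl p) c) = algebraMap C.k C.K (LocalField.padicRingHom C.k p hpk c) :=
    fun c => by rw [← hsc c, AlgEquiv.symm_apply_apply]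
  -- `x̂ := s ∈ ℚ_p ⊆ ℚ̄_p` has absolute value `1`
  have hxn : ‖algebraMap ℚ_[p] (PadicAlgCl p) (s : ℚ_[p])‖ = 1 := by
    rw [norm_algebraMap']
    exact PadicInt.isUnit_iff.mp (Units.isUnit s)
  obtain ⟨y', hy'E, hy'n, hy'log⟩ :=
    PadicAlgCl.exists_mem_adjoin_norm_eq_one_log_eq_mul p (algebraMap ℚ_[p] (PadicAlgCl p) (s : ℚ_[p])) hxn a
  -- `ℚ_p(x̂) = ℚ_p`, so `y'` is a `p`-adic number of absolute value `1`
  have hbot : IntermediateField.adjoin ℚ_[p] ({algebraMap ℚ_[p] (PadicAlgCl p) (s : ℚ_[p])} : Set (PadicAlgCl p)) = ⊥ :=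
    IntermediateField.adjoin_simple_eq_bot_iff.mpr (IntermediateField.mem_bot.mpr ⟨_, rfl⟩)
  rw [hbot, IntermediateField.mem_bot] at hy'E
  obtain ⟨t, rfl⟩ := hy'E
  rw [norm_algebraMap'] at hy'n
  let z : ℤ_[p] := ⟨t, hy'n.le⟩
  have ht1 : ‖z‖ = 1 := hy'n
  obtain ⟨s', hs'⟩ := PadicInt.isUnit_iff.mpr ht1
  refine ⟨s', ?_⟩
  have hs't : ((s' : ℤ_[p]) : ℚ_[p]) = t := by rw [hs']
  rw [hlog, hlog, hsc, hs't, hy'log, map_mul, hsc', hsc]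

end ResidueChar

variable [Fact C.residueChar.Prime]

/-- `ι(ℤ_p^×) ⊆ 𝒪_k̄^×` for THE residue characteristic `p` (`MLFClosure.padicScalar`).
[cite: MochizukiAbsTopIII2015, Definition 3.1 (i) p.66] -/
theorem padicScalar_units_mem_unitSubmonoid (s : ℤ_[C.residueChar]ˣ) : C.padicScalar (s : ℤ_[C.residueChar]) ∈ unitSubmonoid C.k C.K :=
  C.algebraMap_padicRingHom_mem_unitSubmonoid_ofResidueChar C.residueChar C.valuation_ringChar_lt_one s

/-- **`ℤ_p`-multiples of logarithms of `p`-adic units are logarithms of `p`-adic units** (THE logarithm `log_k̄` of the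
`MLFClosure`): for `s ∈ ℤ_p^×`, `a ∈ ℤ_p` there is `s' ∈ ℤ_p^×` with `log_k̄ ι(s') = a · log_k̄ ι(s)`.
[cite: MochizukiAbsTopIII2015, Definition 3.1 (iv) p.69] -/
theorem exists_padicUnit_log_eq_mul (s : ℤ_[C.residueChar]ˣ) (a : ℤ_[C.residueChar]) :
    ∃ s' : ℤ_[C.residueChar]ˣ,
      C.galoisPadicLog.log (C.padicScalar (s' : ℤ_[C.residueChar])) =
        C.padicScalar a * C.galoisPadicLog.log (C.padicScalar (s : ℤ_[C.residueChar])) :=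
  C.exists_padicUnit_log_eq_mul_ofResidueChar C.residueChar C.valuation_ringChar_lt_one s a

/-- `1 + p ∈ ℤ_p^×`. [cite: MochizukiAbsTopIII2015, Definition 3.1 (i) p.66] -/
theorem isUnit_one_add_residueChar :
    IsUnit ((1 : ℤ_[C.residueChar]) + ((C.residueChar : ℕ) : ℤ_[C.residueChar])) := by
  rw [PadicInt.isUnit_iff]
  apply le_antisymm (PadicInt.norm_le_one _)
  have hp : ‖((C.residueChar : ℕ) : ℤ_[C.residueChar])‖ < 1 := (PadicInt.norm_lt_one_iff_dvd _).mpr dvd_rfl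
  by_contra hlt
  rw [not_le] at hlt
  -- `‖1‖ = ‖(1 + p) - p‖ ≤ max ‖1+p‖ ‖p‖ < 1`, contradiction
  have h1 : ‖(1 : ℤ_[C.residueChar])‖ ≤
      max ‖(1 : ℤ_[C.residueChar]) + ((C.residueChar : ℕ) : ℤ_[C.residueChar])‖
        ‖((C.residueChar : ℕ) : ℤ_[C.residueChar])‖ := by
    have := PadicInt.nonarchimedean ((1 : ℤ_[C.residueChar]) + ((C.residueChar : ℕ) : ℤ_[C.residueChar]))
      (-((C.residueChar : ℕ) : ℤ_[C.residueChar]))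
    rw [add_neg_cancel_right, norm_neg] at this
    exact this
  rw [norm_one] at h1
  exact absurd (lt_of_le_of_lt h1 (max_lt hlt hp)) (lt_irrefl 1)

/-- **`log_k̄ ι(1 + p) ≠ 0`**: `1 + p` is a `p`-adic unit which is not a root of unity (`(1+p)^n = 1` with `n ≥ 1` is
impossible already in `ℕ ⊆ k`, `char k = 0`), and `log_k̄` vanishes exactly on the roots of unity.
[cite: MochizukiAbsTopIII2015, Definition 3.1 (i) p.66] -/
theorem log_one_add_residueChar_ne_zero :
    C.galoisPadicLog.log (C.padicScalar (1 + ((C.residueChar : ℕ) : ℤ_[C.residueChar]))) ≠ 0 := by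
  intro h0
  have hu : C.padicScalar (1 + ((C.residueChar : ℕ) : ℤ_[C.residueChar])) ∈ unitSubmonoid C.k C.K := by
    obtain ⟨s, hs⟩ := C.isUnit_one_add_residueChar
    rw [← hs]
    exact C.padicScalar_units_mem_unitSubmonoid s
  obtain ⟨n, hn, hpow⟩ := (C.galoisPadicLog.log_eq_zero_iff _ hu).mp h0
  -- `(1 + p)^n = 1` in `k̄`, hence in `ℕ`
  rw [map_add, map_one, map_natCast, ← Nat.cast_one (R := C.K), ← Nat.cast_add, ← Nat.cast_pow] at hpow
  haveI : CharZero C.K := charZero_of_injective_algebraMap (algebraMap C.k C.K).injective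
  have h1 : (1 + C.residueChar) ^ n = 1 := by exact_mod_cast hpow
  have h2 : 1 < (1 + C.residueChar) ^ n :=
    Nat.one_lt_pow hn.ne' (by have := (Fact.out : C.residueChar.Prime).two_le; omega)
  omega

end MLFClosure

end Literature.AnabelianGeometry.AbsoluteAnabelian

end
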